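import Mathlib
import HarnessLib
import Summits.HubbardSuperconductivity.HubbardSuperconductivity.Theorems.KLProgrammeKLRegimeEngineTowerLevNumericsBounds

/-!
# Route `KLProgramme` — crux K3 ENGINE (stmt-HubbardSuperconductivity-20437 `KLRegimeEngineV17F2`), stub (b) v2, THE LEVELS PACKAGE (ℓ), numerics side
# «(ℓ)-NUMERICS» part 2b (cell gate-hubbard-kl, seat p4 g21): THE SEVEN DOOR TERMS FROM BELOW AND THE CE♯ ROW FROM ABOVE, TIME-MESH-FREE

On the reduced shapes of part 2a (`r := β/M`; `σ = s₀r²`, `τ = t₀r²`, `ψ = p₀/r²`, `Φ = φ₀/r`; `QL/r² ≤ Q′ ≤ QH/r²`; imports `ι₁ ≤ i₁/r`, `ι₂′ ≤ i₂/(B·r³)`,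
`ι₃ ≤ i₃/r⁵`; `aL·r ≤ A ≤ aA·r`, `0 ≤ A′ ≤ aP·r`):
* §2 each of the seven terms of the assembly's coupling doors `U ≤ min 1 (min (1/(8σQ′+1)) (…))/(2BKlam+1)`, `cc ≤ (same min)·log 4/(2BKlam+1)` has an
  `r`-FREE positive lower bound (`levNum_door2` … `levNum_door7`; `levNum_recip_mono`), so ONE threshold `u♭ > 0` sits below the `min` uniformly in `M`;
* §4 for a coupling `0 ≤ λ ≤ 1` below the two doors `λ ≤ 1/(8s₀QH+1)`, `λ ≤ 1/(4φ₀t₀i₁+1)` and under the `B`-smallness `φ₀t₀·sC ≤ 1/4`, the two geometric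
  ratios of `Atot♯` are `≤ 1` (`levNum_x₁_le`, `levNum_y_le`, `levNum_geom_le_one`), the amplitude obeys `Atot♯ ≤ aT·r` (`levNum_Atot_le`), the per-leg-pair
  constant `Qtot·(r/2)² ≤ qT` (`levNum_Qtot_le`), hence the CE♯ row's left-hand side `Qtot·(r/2)²·B·max 1 (Atot♯/(r/2)) ≤ qT·B·max 1 (2aT)`
  (`levNum_CErow_le`) — an `M`-free threshold for the levels package's `CE`.
Pure real arithmetic; nothing about the model is asserted; nothing asserts (ℓ), any stub, K3 or superconductivity.
References: BGM 2006 §2.8 (2.83)–(2.84), (2.93)–(2.98), Lemma 2.5 (2.98) [cite: BenfattoGiulianiMastropietro2006].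
-/

noncomputable section

namespace Summit.HubbardSuperconductivity.HubbardSuperconductivity.Theorems.EngineV8

set_option linter.dupNamespace false -- summit = problem name (single-conjunct summit), D-0017

open Real

/-! ## §2 The seven door terms have time-mesh-free positive lower bounds -/

section Doors

variable {r s₀ t₀ p₀ φ₀ σ τ ψ Φ Q' Q QL QH ρk A A' aL aP ι₁ ι₂' ι₃ i₁ i₂ i₃ B : ℝ}

/-- `1/(b+1) ≤ 1/(a+1)` for `0 ≤ a ≤ b`. [folklore] -/
theorem levNum_recip_mono {a b : ℝ} (ha : 0 ≤ a) (hab : a ≤ b) : 1 / (b + 1) ≤ 1 / (a + 1) :=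
  one_div_le_one_div_of_le (by linarith) (by linarith)

/-- **Door term 2**: `σ = s₀r²`, `0 < Q′ ≤ QH/r²` ⇒ `1/(8s₀QH + 1) ≤ 1/(8σQ′ + 1)`. [folklore] -/
theorem levNum_door2 (hr : 0 < r) (hs₀ : 0 ≤ s₀) (hσ : σ = s₀ * r ^ 2) (hQ'0 : 0 < Q') (hQ'₂ : Q' ≤ QH / r ^ 2) :
    1 / (8 * s₀ * QH + 1) ≤ 1 / (8 * σ * Q' + 1) := by
  have hQr' : Q' * r ^ 2 ≤ QH := (le_div_iff₀ (by positivity)).1 hQ'₂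
  refine levNum_recip_mono (by rw [hσ]; positivity) ?_
  calc 8 * σ * Q' = 8 * s₀ * (Q' * r ^ 2) := by rw [hσ]; ring
    _ ≤ 8 * s₀ * QH := by gcongr

/-- **Door term 3**: `τ = t₀r²`, `0 < Q′ ≤ QH/r²` ⇒ `1/(2e·t₀QH + 1) ≤ 1/(2eτQ′ + 1)`. [folklore] -/
theorem levNum_door3 (hr : 0 < r) (ht₀ : 0 ≤ t₀) (hτ : τ = t₀ * r ^ 2) (hQ'0 : 0 < Q') (hQ'₂ : Q' ≤ QH / r ^ 2) :
    1 / (2 * exp 1 * t₀ * QH + 1) ≤ 1 / (2 * exp 1 * τ * Q' + 1) := by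
  have hQr' : Q' * r ^ 2 ≤ QH := (le_div_iff₀ (by positivity)).1 hQ'₂
  refine levNum_recip_mono (by rw [hτ]; positivity) ?_
  calc 2 * exp 1 * τ * Q' = 2 * exp 1 * t₀ * (Q' * r ^ 2) := by rw [hτ]; ring
    _ ≤ 2 * exp 1 * t₀ * QH := by gcongr

/-- **Door term 4**: `Φ = φ₀/r`, `τ = t₀r²`, `0 ≤ ι₁ ≤ i₁/r` ⇒ `1/(4φ₀t₀i₁ + 1) ≤ 1/(4Φτι₁ + 1)`. [folklore] -/
theorem levNum_door4 (hr : 0 < r) (hφ₀ : 0 ≤ φ₀) (ht₀ : 0 ≤ t₀) (hΦ : Φ = φ₀ / r) (hτ : τ = t₀ * r ^ 2) (hι₁0 : 0 ≤ ι₁) (hι₁ : ι₁ ≤ i₁ / r) :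
    1 / (4 * φ₀ * t₀ * i₁ + 1) ≤ 1 / (4 * Φ * τ * ι₁ + 1) := by
  have hι₁r : ι₁ * r ≤ i₁ := (le_div_iff₀ hr).1 hι₁
  refine levNum_recip_mono (by rw [hΦ, hτ]; positivity) ?_
  calc 4 * Φ * τ * ι₁ = 4 * φ₀ * t₀ * (ι₁ * r) := by rw [hΦ, hτ]; field_simp
    _ ≤ 4 * φ₀ * t₀ * i₁ := by gcongr

/-- **Door term 5**: with `Φ = φ₀/r`, `τ = t₀r²`, `0 ≤ ι₁ ≤ i₁/r`, `0 ≤ ι₂′ ≤ i₂/(B·r³)`, `0 ≤ ι₃ ≤ i₃/r⁵`, `0 ≤ A′ ≤ aP·r`, `0 < Q′ ≤ QH/r²`, the bracket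
`Φ·(eτι₁ + (eτ)²ι₂′ + (eτ)³ι₃ + A′(eτQ′)²/2)` is at most `Σ₅ := e·φ₀t₀i₁ + e²·φ₀t₀²·i₂/B + e³·φ₀t₀³·i₃ + φ₀·aP·e²t₀²·QH²/2`, whence
`1/(2Σ₅ + 1) ≤ 1/(2·Φ·(…) + 1)`. [folklore] -/
theorem levNum_door5 (hr : 0 < r) (hφ₀ : 0 ≤ φ₀) (ht₀ : 0 ≤ t₀) (hB : 1 ≤ B) (hΦ : Φ = φ₀ / r) (hτ : τ = t₀ * r ^ 2)
    (hι₁0 : 0 ≤ ι₁) (hι₁ : ι₁ ≤ i₁ / r) (hι₂0 : 0 ≤ ι₂') (hι₂ : ι₂' ≤ i₂ / (B * r ^ 3)) (hι₃0 : 0 ≤ ι₃) (hι₃ : ι₃ ≤ i₃ / r ^ 5)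
    (hA'0 : 0 ≤ A') (hA' : A' ≤ aP * r) (hQ'0 : 0 < Q') (hQ'₂ : Q' ≤ QH / r ^ 2) :
    Φ * (exp 1 * τ * ι₁ + (exp 1 * τ) ^ 2 * ι₂' + (exp 1 * τ) ^ 3 * ι₃ + A' * (exp 1 * τ * Q') ^ 2 / 2) ≤
        exp 1 * φ₀ * t₀ * i₁ + exp 1 ^ 2 * φ₀ * t₀ ^ 2 * (i₂ / B) + exp 1 ^ 3 * φ₀ * t₀ ^ 3 * i₃ + φ₀ * aP * exp 1 ^ 2 * t₀ ^ 2 * QH ^ 2 / 2 ∧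
      1 / (2 * (exp 1 * φ₀ * t₀ * i₁ + exp 1 ^ 2 * φ₀ * t₀ ^ 2 * (i₂ / B) + exp 1 ^ 3 * φ₀ * t₀ ^ 3 * i₃ + φ₀ * aP * exp 1 ^ 2 * t₀ ^ 2 * QH ^ 2 / 2) + 1) ≤
        1 / (2 * (Φ * (exp 1 * τ * ι₁ + (exp 1 * τ) ^ 2 * ι₂' + (exp 1 * τ) ^ 3 * ι₃ + A' * (exp 1 * τ * Q') ^ 2 / 2)) + 1) := by
  have hB0 : 0 < B := by linarith
  have hι₁r : ι₁ * r ≤ i₁ := (le_div_iff₀ hr).1 hι₁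
  have hι₂r : ι₂' * (B * r ^ 3) ≤ i₂ := (le_div_iff₀ (by positivity)).1 hι₂
  have hι₃r : ι₃ * r ^ 5 ≤ i₃ := (le_div_iff₀ (by positivity)).1 hι₃
  have hQr' : Q' * r ^ 2 ≤ QH := (le_div_iff₀ (by positivity)).1 hQ'₂
  have haP : 0 ≤ aP * r := hA'0.trans hA'
  have haP0 : 0 ≤ aP := by
    rcases le_or_gt 0 aP with h' | h'
    · exact h'
    · exact absurd haP (not_le.2 (mul_neg_of_neg_of_pos h' hr))
  have hmain : Φ * (exp 1 * τ * ι₁ + (exp 1 * τ) ^ 2 * ι₂' + (exp 1 * τ) ^ 3 * ι₃ + A' * (exp 1 * τ * Q') ^ 2 / 2) ≤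
      exp 1 * φ₀ * t₀ * i₁ + exp 1 ^ 2 * φ₀ * t₀ ^ 2 * (i₂ / B) + exp 1 ^ 3 * φ₀ * t₀ ^ 3 * i₃ + φ₀ * aP * exp 1 ^ 2 * t₀ ^ 2 * QH ^ 2 / 2 := by
    have e1 : Φ * (exp 1 * τ * ι₁) = exp 1 * φ₀ * t₀ * (ι₁ * r) := by rw [hΦ, hτ]; field_simp
    have e2 : Φ * ((exp 1 * τ) ^ 2 * ι₂') = exp 1 ^ 2 * φ₀ * t₀ ^ 2 * (ι₂' * (B * r ^ 3) / B) := by rw [hΦ, hτ]; field_simp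
    have e3 : Φ * ((exp 1 * τ) ^ 3 * ι₃) = exp 1 ^ 3 * φ₀ * t₀ ^ 3 * (ι₃ * r ^ 5) := by rw [hΦ, hτ]; field_simp
    have e4 : Φ * (A' * (exp 1 * τ * Q') ^ 2 / 2) = φ₀ * (A' * r ^ 3) * exp 1 ^ 2 * t₀ ^ 2 * (Q' * r ^ 2) ^ 2 / 2 / r ^ 4 := by
      rw [hΦ, hτ]; field_simp
    have h4 : φ₀ * (A' * r ^ 3) * exp 1 ^ 2 * t₀ ^ 2 * (Q' * r ^ 2) ^ 2 / 2 / r ^ 4 ≤ φ₀ * aP * exp 1 ^ 2 * t₀ ^ 2 * QH ^ 2 / 2 := by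
      rw [div_le_iff₀ (by positivity)]
      have hA'r : A' * r ^ 3 ≤ aP * r ^ 4 := by nlinarith [mul_le_mul_of_nonneg_right hA' (by positivity : (0:ℝ) ≤ r ^ 3)]
      calc φ₀ * (A' * r ^ 3) * exp 1 ^ 2 * t₀ ^ 2 * (Q' * r ^ 2) ^ 2 / 2 ≤ φ₀ * (aP * r ^ 4) * exp 1 ^ 2 * t₀ ^ 2 * QH ^ 2 / 2 := by gcongr
        _ = φ₀ * aP * exp 1 ^ 2 * t₀ ^ 2 * QH ^ 2 / 2 * r ^ 4 := by ring
    have h1 : exp 1 * φ₀ * t₀ * (ι₁ * r) ≤ exp 1 * φ₀ * t₀ * i₁ := by gcongr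
    have h2 : exp 1 ^ 2 * φ₀ * t₀ ^ 2 * (ι₂' * (B * r ^ 3) / B) ≤ exp 1 ^ 2 * φ₀ * t₀ ^ 2 * (i₂ / B) := by gcongr
    have h3 : exp 1 ^ 3 * φ₀ * t₀ ^ 3 * (ι₃ * r ^ 5) ≤ exp 1 ^ 3 * φ₀ * t₀ ^ 3 * i₃ := by gcongr
    rw [mul_add, mul_add, mul_add, e1, e2, e3, e4]
    linarith
  refine ⟨hmain, levNum_recip_mono (by rw [hΦ, hτ]; positivity) (by linarith)⟩

/-- **Door term 6**: `σ = s₀r²`, `0 < Q′ ≤ QH/r²`, `aL·r ≤ A` (`aL > 0`), `0 ≤ A′ ≤ aP·r`, `Q = ρk·Q′` (`ρk > 0`) ⇒ with `R₆ := 1024·s₀·aP·QH/(aL·ρk³)`: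
`1/(R₆ + 1) ≤ A·Q³/(16σQ′A′(4Q′)³ + A·Q³)`. [folklore] -/
theorem levNum_door6 (hr : 0 < r) (hs₀ : 0 ≤ s₀) (hσ : σ = s₀ * r ^ 2) (hQ'0 : 0 < Q') (hQ'₂ : Q' ≤ QH / r ^ 2) (haL : 0 < aL) (hA : aL * r ≤ A)
    (hA'0 : 0 ≤ A') (hA' : A' ≤ aP * r) (hρk : 0 < ρk) (hQ : Q = ρk * Q') :
    1 / (1024 * s₀ * aP * QH / (aL * ρk ^ 3) + 1) ≤ A * Q ^ 3 / (16 * σ * Q' * A' * (4 * Q') ^ 3 + A * Q ^ 3) := by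
  have hQr' : Q' * r ^ 2 ≤ QH := (le_div_iff₀ (by positivity)).1 hQ'₂
  have hA0 : 0 < A := lt_of_lt_of_le (by positivity) hA
  have hAQ : 0 < A * Q ^ 3 := by rw [hQ]; positivity
  have haP : 0 ≤ aP * r := hA'0.trans hA'
  have hQH0 : 0 ≤ QH := le_trans (by positivity) hQr'
  have hX0 : 0 ≤ 16 * σ * Q' * A' * (4 * Q') ^ 3 := by rw [hσ]; positivity
  -- `16σQ′A′(4Q′)³ ≤ R₆ · A Q³`
  have hX : 16 * σ * Q' * A' * (4 * Q') ^ 3 ≤ 1024 * s₀ * aP * QH / (aL * ρk ^ 3) * (A * Q ^ 3) := by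
    rw [hσ, hQ, div_mul_eq_mul_div, le_div_iff₀ (by positivity)]
    calc 16 * (s₀ * r ^ 2) * Q' * A' * (4 * Q') ^ 3 * (aL * ρk ^ 3) = 1024 * s₀ * (Q' * r ^ 2) * A' * (aL * r) * (ρk * Q') ^ 3 / r := by
          field_simp; ring
      _ ≤ 1024 * s₀ * QH * (aP * r) * A * (ρk * Q') ^ 3 / r := by gcongr
      _ = 1024 * s₀ * aP * QH * (A * (ρk * Q') ^ 3) := by field_simp
  have hR1 : 0 < 1024 * s₀ * aP * QH / (aL * ρk ^ 3) + 1 := by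
    have : 0 ≤ 1024 * s₀ * aP * QH / (aL * ρk ^ 3) * (A * Q ^ 3) := hX0.trans hX
    have h' : 0 ≤ 1024 * s₀ * aP * QH / (aL * ρk ^ 3) := by
      rcases le_or_gt 0 (1024 * s₀ * aP * QH / (aL * ρk ^ 3)) with h' | h'
      · exact h'
      · exact absurd this (not_le.2 (mul_neg_of_neg_of_pos h' hAQ))
    linarith
  rw [div_le_div_iff₀ hR1 (by positivity), one_mul]
  calc 16 * σ * Q' * A' * (4 * Q') ^ 3 + A * Q ^ 3 ≤ 1024 * s₀ * aP * QH / (aL * ρk ^ 3) * (A * Q ^ 3) + A * Q ^ 3 := by linarith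
    _ = A * Q ^ 3 * (1024 * s₀ * aP * QH / (aL * ρk ^ 3) + 1) := by ring

/-- **Door term 7**: `ψ = p₀/r²`, `τ = t₀r²`, `Φ = φ₀/r`, `0 ≤ ι₁ ≤ i₁/r`, `QL/r² ≤ Q′ ≤ QH/r²` (`QL > 0`), `aL·r ≤ A` (`aL > 0`), `Q = ρk·Q′` (`ρk > 0`) ⇒ with
`R₇ := 64·e·p₀³t₀⁴φ₀·QH²·i₁²/(aL·ρk³·QL³)`: `1/(R₇ + 1) ≤ A·Q³/(16eψ(2τψQ′)²Φτ²ι₁² + A·Q³)`. [folklore] -/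
theorem levNum_door7 (hr : 0 < r) (hp₀ : 0 ≤ p₀) (hφ₀ : 0 ≤ φ₀) (hψ : ψ = p₀ / r ^ 2) (hτ : τ = t₀ * r ^ 2) (hΦ : Φ = φ₀ / r)
    (hι₁0 : 0 ≤ ι₁) (hι₁ : ι₁ ≤ i₁ / r) (hQL : 0 < QL) (hQ'₁ : QL / r ^ 2 ≤ Q') (hQ'₂ : Q' ≤ QH / r ^ 2) (haL : 0 < aL) (hA : aL * r ≤ A)
    (hρk : 0 < ρk) (hQ : Q = ρk * Q') :
    1 / (64 * exp 1 * p₀ ^ 3 * t₀ ^ 4 * φ₀ * QH ^ 2 * i₁ ^ 2 / (aL * ρk ^ 3 * QL ^ 3) + 1) ≤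
      A * Q ^ 3 / (16 * exp 1 * ψ * (2 * τ * ψ * Q') ^ 2 * Φ * τ ^ 2 * ι₁ ^ 2 + A * Q ^ 3) := by
  have hQ'0 : 0 < Q' := lt_of_lt_of_le (by positivity) hQ'₁
  have hQr : QL ≤ Q' * r ^ 2 := (div_le_iff₀ (by positivity)).1 hQ'₁
  have hQr' : Q' * r ^ 2 ≤ QH := (le_div_iff₀ (by positivity)).1 hQ'₂
  have hι₁r : ι₁ * r ≤ i₁ := (le_div_iff₀ hr).1 hι₁
  have hA0 : 0 < A := lt_of_lt_of_le (by positivity) hA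
  have hAQ : 0 < A * Q ^ 3 := by rw [hQ]; positivity
  have hX0 : 0 ≤ 16 * exp 1 * ψ * (2 * τ * ψ * Q') ^ 2 * Φ * τ ^ 2 * ι₁ ^ 2 := by rw [hψ, hτ, hΦ]; positivity
  have hX : 16 * exp 1 * ψ * (2 * τ * ψ * Q') ^ 2 * Φ * τ ^ 2 * ι₁ ^ 2 ≤
      64 * exp 1 * p₀ ^ 3 * t₀ ^ 4 * φ₀ * QH ^ 2 * i₁ ^ 2 / (aL * ρk ^ 3 * QL ^ 3) * (A * Q ^ 3) := by
    rw [hψ, hτ, hΦ, hQ, div_mul_eq_mul_div, le_div_iff₀ (by positivity)]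
    calc 16 * exp 1 * (p₀ / r ^ 2) * (2 * (t₀ * r ^ 2) * (p₀ / r ^ 2) * Q') ^ 2 * (φ₀ / r) * (t₀ * r ^ 2) ^ 2 * ι₁ ^ 2 * (aL * ρk ^ 3 * QL ^ 3)
        = 64 * exp 1 * p₀ ^ 3 * t₀ ^ 4 * φ₀ * (Q' * r ^ 2) ^ 2 * (ι₁ * r) ^ 2 * (aL * r) * ρk ^ 3 * QL ^ 3 / r ^ 6 := by
          field_simp; ring
      _ ≤ 64 * exp 1 * p₀ ^ 3 * t₀ ^ 4 * φ₀ * QH ^ 2 * i₁ ^ 2 * A * ρk ^ 3 * (Q' * r ^ 2) ^ 3 / r ^ 6 := by gcongr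
      _ = 64 * exp 1 * p₀ ^ 3 * t₀ ^ 4 * φ₀ * QH ^ 2 * i₁ ^ 2 * (A * (ρk * Q') ^ 3) := by field_simp
  have hR1 : 0 < 64 * exp 1 * p₀ ^ 3 * t₀ ^ 4 * φ₀ * QH ^ 2 * i₁ ^ 2 / (aL * ρk ^ 3 * QL ^ 3) + 1 := by
    have : 0 ≤ 64 * exp 1 * p₀ ^ 3 * t₀ ^ 4 * φ₀ * QH ^ 2 * i₁ ^ 2 / (aL * ρk ^ 3 * QL ^ 3) * (A * Q ^ 3) := hX0.trans hX
    have h' : 0 ≤ 64 * exp 1 * p₀ ^ 3 * t₀ ^ 4 * φ₀ * QH ^ 2 * i₁ ^ 2 / (aL * ρk ^ 3 * QL ^ 3) := by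
      rcases le_or_gt 0 (64 * exp 1 * p₀ ^ 3 * t₀ ^ 4 * φ₀ * QH ^ 2 * i₁ ^ 2 / (aL * ρk ^ 3 * QL ^ 3)) with h' | h'
      · exact h'
      · exact absurd this (not_le.2 (mul_neg_of_neg_of_pos h' hAQ))
    linarith
  rw [div_le_div_iff₀ hR1 (by positivity), one_mul]
  calc 16 * exp 1 * ψ * (2 * τ * ψ * Q') ^ 2 * Φ * τ ^ 2 * ι₁ ^ 2 + A * Q ^ 3
      ≤ 64 * exp 1 * p₀ ^ 3 * t₀ ^ 4 * φ₀ * QH ^ 2 * i₁ ^ 2 / (aL * ρk ^ 3 * QL ^ 3) * (A * Q ^ 3) + A * Q ^ 3 := by linarith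
    _ = A * Q ^ 3 * (64 * exp 1 * p₀ ^ 3 * t₀ ^ 4 * φ₀ * QH ^ 2 * i₁ ^ 2 / (aL * ρk ^ 3 * QL ^ 3) + 1) := by ring

end Doors

/-! ## §4 The CE♯ row has a time-mesh-free right-hand side once the coupling is below the doors -/

section CERow

variable {r s₀ t₀ p₀ φ₀ σ τ ψ Φ Q' Q QL QH Qb qhi ρk lam ι₁ ι₂' ι₃ i₁ i₂ i₃ A A' aA aP Ab' a_b B C₁' C₂' Cinc Dinc Aro Qro Qtot Atot sC S : ℝ}
  {d : ℕ}

/-- `x/(1 − x) ≤ 1` for `x ≤ 1/2`. [folklore] -/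
theorem levNum_geom_le_one {x : ℝ} (hx : x ≤ 1 / 2) : x / (1 - x) ≤ 1 := by
  rw [div_le_one (by linarith)]; linarith

/-- **`x₁ ≤ 1/2`**: `σ = s₀r²`, `Q′ ≤ QH/r²`, `0 ≤ λ ≤ 1/(8s₀QH + 1)` ⇒ `4σλQ′ ≤ 1/2`. [folklore] -/
theorem levNum_x₁_le (hr : 0 < r) (hs₀ : 0 ≤ s₀) (hσ : σ = s₀ * r ^ 2) (hQ'0 : 0 < Q') (hQ'₂ : Q' ≤ QH / r ^ 2) (hlam0 : 0 ≤ lam)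
    (hlam2 : lam ≤ 1 / (8 * s₀ * QH + 1)) : 0 ≤ 4 * σ * lam * Q' ∧ 4 * σ * lam * Q' ≤ 1 / 2 := by
  have hQr' : Q' * r ^ 2 ≤ QH := (le_div_iff₀ (by positivity)).1 hQ'₂
  have hQH0 : 0 ≤ QH := le_trans (by positivity) hQr'
  refine ⟨by rw [hσ]; positivity, ?_⟩
  have h1 : 4 * σ * lam * Q' = 4 * s₀ * (Q' * r ^ 2) * lam := by rw [hσ]; ring
  have h2 : 4 * s₀ * (Q' * r ^ 2) * lam ≤ 4 * s₀ * QH * lam := by gcongr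
  have h3 : 4 * s₀ * QH * lam ≤ 4 * s₀ * QH * (1 / (8 * s₀ * QH + 1)) := by gcongr
  have h4 : 4 * s₀ * QH * (1 / (8 * s₀ * QH + 1)) ≤ 1 / 2 := by
    rw [mul_one_div, div_le_iff₀ (by positivity)]; nlinarith [mul_nonneg hs₀ hQH0]
  linarith

/-- **`y ≤ 1/2`**: `Φ = φ₀/r`, `τ = t₀r²`, `0 ≤ S ≤ (i₁λ + sC)/r`, `0 ≤ λ ≤ 1/(4φ₀t₀i₁ + 1)`, `φ₀t₀·sC ≤ 1/4` ⇒ `0 ≤ Φ(τS) ≤ 1/2`. [folklore] -/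
theorem levNum_y_le (hr : 0 < r) (ht₀ : 0 ≤ t₀) (hφ₀ : 0 ≤ φ₀) (hΦ : Φ = φ₀ / r) (hτ : τ = t₀ * r ^ 2) (hS0 : 0 ≤ S) (hS : S ≤ (i₁ * lam + sC) / r)
    (hi₁ : 0 ≤ i₁) (hlam4 : lam ≤ 1 / (4 * φ₀ * t₀ * i₁ + 1)) (hsmall : φ₀ * t₀ * sC ≤ 1 / 4) :
    0 ≤ Φ * (τ * S) ∧ Φ * (τ * S) ≤ 1 / 2 := by
  refine ⟨by rw [hΦ, hτ]; positivity, ?_⟩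
  have h1 : Φ * (τ * S) = φ₀ * t₀ * (S * r) := by rw [hΦ, hτ]; field_simp
  have h2 : S * r ≤ i₁ * lam + sC := (le_div_iff₀ hr).1 hS
  have h31 : φ₀ * t₀ * (i₁ * lam) ≤ φ₀ * t₀ * i₁ * (1 / (4 * φ₀ * t₀ * i₁ + 1)) := by
    rw [show φ₀ * t₀ * (i₁ * lam) = φ₀ * t₀ * i₁ * lam by ring]; gcongr
  have h32 : φ₀ * t₀ * i₁ * (1 / (4 * φ₀ * t₀ * i₁ + 1)) ≤ 1 / 4 := by
    rw [mul_one_div, div_le_iff₀ (by positivity)]; nlinarith [mul_nonneg (mul_nonneg hφ₀ ht₀) hi₁]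
  calc Φ * (τ * S) = φ₀ * t₀ * (S * r) := h1
    _ ≤ φ₀ * t₀ * (i₁ * lam + sC) := by gcongr
    _ = φ₀ * t₀ * (i₁ * lam) + φ₀ * t₀ * sC := by ring
    _ ≤ 1 / 4 + 1 / 4 := add_le_add (h31.trans h32) hsmall
    _ = 1 / 2 := by norm_num

/-- **The amplitude `Atot♯ ≤ aT·r`** from the two geometric ratios (`x₁, y ≤ 1/2`), `S ≤ (i₁ + sC)/r`, `QL/r² ≤ Q′`, `A ≤ aA·r`, `0 ≤ A′ ≤ aP·r`,
`Ab′ = a_b·r/B²`, `2 ≤ d`. [folklore] -/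
theorem levNum_Atot_le (hr : 0 < r) (hτ0 : 0 < τ) (hQL : 0 < QL) (hQ'₁ : QL / r ^ 2 ≤ Q') (hS0 : 0 ≤ S) (hS' : S ≤ (i₁ + sC) / r)
    (hx₁ : 4 * σ * lam * Q' ≤ 1 / 2) (hy : Φ * (τ * S) ≤ 1 / 2)
    (hA0 : 0 ≤ A) (hA : A ≤ aA * r) (hA'0 : 0 ≤ A') (hA' : A' ≤ aP * r) (hAb' : Ab' = a_b * r / B ^ 2)
    (hC₁' : 0 ≤ C₁') (hC₂' : 0 < C₂') (hCinc : 0 ≤ Cinc) (hd : 2 ≤ d)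
    (hAro : Aro = (27 : ℝ) ^ 5 * (C₁' / C₂') * (Ab' + (8 : ℝ) ^ (d - 1) * (A / (1 - ((2 : ℝ) ^ d)⁻¹))))
    (hAtot : Atot = Aro + Cinc * (A' * (4 * σ * lam * Q' / (1 - 4 * σ * lam * Q')) +
      exp 1 * (τ * S) * (Φ * (τ * S) / (1 - Φ * (τ * S))) / (2 * τ * Q'))) :
    Atot ≤ ((27 : ℝ) ^ 5 * (C₁' / C₂') * (a_b / B ^ 2 + 4 / 3 * (8 : ℝ) ^ (d - 1) * aA) + Cinc * (aP + exp 1 * (i₁ + sC) / (2 * QL))) * r := by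
  have hQ'0 : 0 < Q' := lt_of_lt_of_le (by positivity) hQ'₁
  have hQr : QL ≤ Q' * r ^ 2 := (div_le_iff₀ (by positivity)).1 hQ'₁
  have hSr : S * r ≤ i₁ + sC := (le_div_iff₀ hr).1 hS'
  have hisC : 0 ≤ i₁ + sC := le_trans (by positivity) hSr
  have hgeo₁ : A' * (4 * σ * lam * Q' / (1 - 4 * σ * lam * Q')) ≤ aP * r :=
    (mul_le_of_le_one_right hA'0 (levNum_geom_le_one hx₁)).trans hA'
  have hgeo₂ : exp 1 * (τ * S) * (Φ * (τ * S) / (1 - Φ * (τ * S))) / (2 * τ * Q') ≤ exp 1 * (i₁ + sC) / (2 * QL) * r := by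
    have h1 : exp 1 * (τ * S) * (Φ * (τ * S) / (1 - Φ * (τ * S))) ≤ exp 1 * (τ * S) :=
      mul_le_of_le_one_right (by positivity) (levNum_geom_le_one hy)
    calc exp 1 * (τ * S) * (Φ * (τ * S) / (1 - Φ * (τ * S))) / (2 * τ * Q') ≤ exp 1 * (τ * S) / (2 * τ * Q') :=
          div_le_div_of_nonneg_right h1 (by positivity)
      _ = exp 1 * (S * r) * QL / (QL * r) / (2 * Q') := by field_simp
      _ ≤ exp 1 * (i₁ + sC) * (Q' * r ^ 2) / (QL * r) / (2 * Q') := by gcongr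
      _ = exp 1 * (i₁ + sC) / (2 * QL) * r := by field_simp
  have hρ₁ : (3 : ℝ) / 4 ≤ 1 - ((2 : ℝ) ^ d)⁻¹ := by
    have h4 : (4 : ℝ) ≤ (2 : ℝ) ^ d := by
      calc (4 : ℝ) = 2 ^ 2 := by norm_num
        _ ≤ 2 ^ d := pow_le_pow_right₀ (by norm_num) hd
    have : ((2 : ℝ) ^ d)⁻¹ ≤ 1 / 4 := by rw [one_div]; exact inv_anti₀ (by norm_num) h4
    linarith
  have hAro' : Aro ≤ (27 : ℝ) ^ 5 * (C₁' / C₂') * (a_b / B ^ 2 + 4 / 3 * (8 : ℝ) ^ (d - 1) * aA) * r := by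
    have h1 : A / (1 - ((2 : ℝ) ^ d)⁻¹) ≤ aA * r / (3 / 4) := div_le_div₀ (hA0.trans hA) hA (by norm_num) hρ₁
    rw [hAro, hAb']
    calc (27 : ℝ) ^ 5 * (C₁' / C₂') * (a_b * r / B ^ 2 + (8 : ℝ) ^ (d - 1) * (A / (1 - ((2 : ℝ) ^ d)⁻¹)))
        ≤ (27 : ℝ) ^ 5 * (C₁' / C₂') * (a_b * r / B ^ 2 + (8 : ℝ) ^ (d - 1) * (aA * r / (3 / 4))) := by gcongr
      _ = (27 : ℝ) ^ 5 * (C₁' / C₂') * (a_b / B ^ 2 + 4 / 3 * (8 : ℝ) ^ (d - 1) * aA) * r := by ring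
  have h2 : A' * (4 * σ * lam * Q' / (1 - 4 * σ * lam * Q')) + exp 1 * (τ * S) * (Φ * (τ * S) / (1 - Φ * (τ * S))) / (2 * τ * Q') ≤
      (aP + exp 1 * (i₁ + sC) / (2 * QL)) * r := by linarith
  have h3 := mul_le_mul_of_nonneg_left h2 hCinc
  rw [hAtot]; linarith

/-- **The per-leg-pair constant `Qtot·(r/2)² ≤ qT`**: `τψ = t₀p₀`, `0 < Q′ ≤ QH/r²`, `0 ≤ Qb ≤ qhi/r²`, `Q = ρkQ′`, `0 < r ≤ 1`. [folklore] -/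
theorem levNum_Qtot_le (hr : 0 < r) (hr1 : r ≤ 1) (ht₀ : 0 ≤ t₀) (hp₀ : 0 ≤ p₀) (hτ : τ = t₀ * r ^ 2) (hψ : ψ = p₀ / r ^ 2)
    (hQ'0 : 0 < Q') (hQ'₂ : Q' ≤ QH / r ^ 2) (hQb0 : 0 ≤ Qb) (hQb : Qb ≤ qhi / r ^ 2) (hρk : 0 < ρk) (hQ : Q = ρk * Q') (hDinc : 1 ≤ Dinc)
    (hQro : Qro = C₂' ^ 2 * max Qb (((2 : ℝ) ^ (d - 1))⁻¹ * max Q Qb)) (hQtot : Qtot = Dinc * max 1 (max Qro (max (4 * Q') (2 * τ * ψ * Q')))) :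
    0 ≤ Qtot ∧ Qtot * (r / 2) ^ 2 ≤ Dinc * (1 + C₂' ^ 2 * (2 * qhi + ρk * QH) + 4 * QH + 2 * t₀ * p₀ * QH) / 4 := by
  have hQr' : Q' * r ^ 2 ≤ QH := (le_div_iff₀ (by positivity)).1 hQ'₂
  have hQbr : Qb * r ^ 2 ≤ qhi := (le_div_iff₀ (by positivity)).1 hQb
  have hD0 : 0 ≤ Dinc := by linarith
  refine ⟨by rw [hQtot]; exact mul_nonneg hD0 (le_trans zero_le_one (le_max_left _ _)), ?_⟩
  have hτψ : 2 * τ * ψ * Q' = 2 * t₀ * p₀ * Q' := by rw [hτ, hψ]; field_simp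
  have hQ0 : 0 ≤ Q := by rw [hQ]; positivity
  have hm₁ : max Qb (((2 : ℝ) ^ (d - 1))⁻¹ * max Q Qb) ≤ 2 * Qb + Q := by
    have h2 : ((2 : ℝ) ^ (d - 1))⁻¹ ≤ 1 := inv_le_one_of_one_le₀ (one_le_pow₀ (by norm_num))
    refine max_le (by linarith) ?_
    calc ((2 : ℝ) ^ (d - 1))⁻¹ * max Q Qb ≤ 1 * max Q Qb := mul_le_mul_of_nonneg_right h2 (le_trans hQ0 (le_max_left _ _))
      _ ≤ 2 * Qb + Q := by rw [one_mul]; exact max_le (by linarith) (by linarith)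
  have hQro' : Qro * r ^ 2 ≤ C₂' ^ 2 * (2 * qhi + ρk * QH) := by
    rw [hQro]
    calc C₂' ^ 2 * max Qb (((2 : ℝ) ^ (d - 1))⁻¹ * max Q Qb) * r ^ 2 ≤ C₂' ^ 2 * (2 * Qb + Q) * r ^ 2 := by gcongr
      _ = C₂' ^ 2 * (2 * (Qb * r ^ 2) + ρk * (Q' * r ^ 2)) := by rw [hQ]; ring
      _ ≤ C₂' ^ 2 * (2 * qhi + ρk * QH) := by gcongr
  have hQro0 : 0 ≤ Qro := by rw [hQro]; exact mul_nonneg (sq_nonneg _) (le_max_of_le_left hQb0)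
  have hr2 : r ^ 2 ≤ 1 := pow_le_one₀ hr.le hr1
  have h4 : 0 ≤ 4 * Q' := by positivity
  have h5 : 0 ≤ 2 * τ * ψ * Q' := by rw [hτψ]; positivity
  have h1 : max 1 (max Qro (max (4 * Q') (2 * τ * ψ * Q'))) ≤ 1 + Qro + 4 * Q' + 2 * τ * ψ * Q' :=
    max_le (by linarith) (max_le (by linarith) (max_le (by linarith) (by linarith)))
  have hm : max 1 (max Qro (max (4 * Q') (2 * τ * ψ * Q'))) * r ^ 2 ≤ 1 + C₂' ^ 2 * (2 * qhi + ρk * QH) + 4 * QH + 2 * t₀ * p₀ * QH := by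
    calc max 1 (max Qro (max (4 * Q') (2 * τ * ψ * Q'))) * r ^ 2 ≤ (1 + Qro + 4 * Q' + 2 * τ * ψ * Q') * r ^ 2 :=
          mul_le_mul_of_nonneg_right h1 (by positivity)
      _ = r ^ 2 + Qro * r ^ 2 + 4 * (Q' * r ^ 2) + 2 * t₀ * p₀ * (Q' * r ^ 2) := by rw [hτψ]; ring
      _ ≤ 1 + C₂' ^ 2 * (2 * qhi + ρk * QH) + 4 * QH + 2 * t₀ * p₀ * QH := by gcongr
  rw [hQtot]
  calc Dinc * max 1 (max Qro (max (4 * Q') (2 * τ * ψ * Q'))) * (r / 2) ^ 2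
      = Dinc * (max 1 (max Qro (max (4 * Q') (2 * τ * ψ * Q'))) * r ^ 2) / 4 := by ring
    _ ≤ Dinc * (1 + C₂' ^ 2 * (2 * qhi + ρk * QH) + 4 * QH + 2 * t₀ * p₀ * QH) / 4 := by gcongr

/-- **THE CE♯ ROW FROM ABOVE** — the assembly: `Qtot·(r/2)²·B·max 1 (Atot♯/(r/2)) ≤ qT·B·max 1 (2aT)` from `levNum_Qtot_le` and `levNum_Atot_le`
(`qT, aT` their `r`-free right-hand sides), for `0 < r`, `1 ≤ B`. [cite: BenfattoGiulianiMastropietro2006, §2.8 (2.93)-(2.98), Lemma 2.5 (2.98)] -/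
theorem levNum_CErow_le {qT aT : ℝ} (hr : 0 < r) (hB : 1 ≤ B) (hQtot0 : 0 ≤ Qtot) (hQtot : Qtot * (r / 2) ^ 2 ≤ qT) (hAtot : Atot ≤ aT * r) :
    Qtot * (r / 2) ^ 2 * B * max 1 (Atot / (r / 2)) ≤ qT * B * max 1 (2 * aT) := by
  have hmax : max 1 (Atot / (r / 2)) ≤ max 1 (2 * aT) := by
    refine max_le_max le_rfl ?_
    rw [div_le_iff₀ (by positivity)]; linarith
  have hB0 : 0 ≤ B := by linarith
  have h0 : 0 ≤ Qtot * (r / 2) ^ 2 := by positivity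
  calc Qtot * (r / 2) ^ 2 * B * max 1 (Atot / (r / 2)) ≤ qT * B * max 1 (Atot / (r / 2)) := by gcongr
    _ ≤ qT * B * max 1 (2 * aT) := by
        refine mul_le_mul_of_nonneg_left hmax ?_
        exact mul_nonneg (h0.trans hQtot) hB0

end CERow

end Summit.HubbardSuperconductivity.HubbardSuperconductivity.Theorems.EngineV8

end
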